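import Literature.Probability.Percolation.DecisionTreeWeightedMeasure
import Summits.CriticalPhenomena.PercolationContinuityZ3.Theorems.PercNearOneGluingNoHeavyQuantThreeClusterSwapCover
import HarnessLib

/-!
# The product row F1 reduces to the doubly-sealed-failure set `B`:
# `P(abc)·P(a|b|c) ≤ P(ab|c) + P(ac|b) + P⊗P(B)` (finitary weighted form)

builds on p205010 (kernel theorem, internal audit signed; external expert review pending)

Support file (`--supports stmt-CriticalPhenomena-4575`), seat `prim-quant-p1` (gen 40); memo
`run/shared/lean/prim/quant/prim-quant-p1-g40/FOR-LEAD-Z32-SWAPCOVER.md` §1 (reduction (R)).  No definitions, no named facts,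
no sorries; standard axioms.

Statement in Gladkov's finitary two-configuration calculus (`DecisionTree.PrW`, `Pr2W`, edge weights `p ∈ [0,1]`, all
configurations of the finite edge type `Sym2 V`, `D = univ`): for vertices `a, b, c`,
  `PrW{a↔b ∧ a↔c} · PrW{a|b|c} ≤ PrW{ab|c} + PrW{ac|b} + Pr2W(B)`,
where `B` is the set of pairs `(C₂, C₁)` with `C₂ ∈ a|b|c`, `C₁ ∈ abc`, and BOTH single seals failing: `b` is not joined to `a` by
`C₁`-open edges avoiding the `C₂`-cluster of `c`, and `c` is not joined to `a` by `C₁`-open edges avoiding the `C₂`-cluster of `b`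
(`productRow_le_add_Pr2W`).  Proof = the weight-preserving swap along the edges touching `C_c(C₂)` (a SELF-DETERMINED set of the
first configuration, `selfDetermined_touchCluster`, so `DecisionTree.Pr2W_preimage_swapPair` — Gladkov 2024, Lemma 3.1 — applies),
whose first output is the sealed configuration `Y_c` of `ThreeClusterSwap.seal_reachable_iff_of_not_mem`, which lies in `ab|c`
exactly on the pairs where `b` is in the `C₁`-cluster of `a` avoiding `C_c(C₂)`; symmetrically for `b`.  So the product row F1
with constant `1 + m` follows from any bound `Pr2W(B) ≤ m·(PrW{ab|c} + PrW{ac|b})` (memo §5: the open decoding problem; `m ≤ 2`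
gives the hypothesis of ✓ p560550 `ThreePort.le_one_reached_le_of_productRow3`).
-/

namespace Summit.CriticalPhenomena.PercolationContinuityZ3.Theorems

open Literature.Probability.Percolation Literature.Probability.Percolation.DecisionTree
open scoped Classical

variable {V : Type*} [Fintype V] [DecidableEq V]

namespace ThreeClusterSwap

omit [Fintype V] in
/-- Coercion of a splice of finite edge sets: `↑(S₁ →_F S₂) = (↑S₁ ∩ ↑F) ∪ (↑S₂ ∖ ↑F)`. [this work] -/
theorem coe_splice (F S₁ S₂ : Finset (Sym2 V)) :
    (↑(splice F S₁ S₂) : Set (Sym2 V)) = ((↑S₁ : Set (Sym2 V)) ∩ ↑F) ∪ (↑S₂ \ ↑F) := by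
  ext e
  simp only [Finset.mem_coe, mem_splice, Set.mem_union, Set.mem_inter_iff, Set.mem_sdiff]
  tauto

/-- The set of edges touching the `C₂`-cluster of `t` is SELF-DETERMINED (Gladkov's condition for Lemma 3.1): a configuration
agreeing with `C₂` on those edges has the same cluster of `t`, hence the same set. [this work] -/
theorem selfDetermined_touchCluster (t : V) :
    SelfDetermined (fun S : Finset (Sym2 V) =>
      Finset.univ.filter fun e => ∃ v ∈ {v | (openGraph (↑S : Set (Sym2 V))).Reachable t v}, v ∈ e) := by
  intro S S' hagree
  have key : ∀ u w, (openGraph (↑S : Set (Sym2 V))).Reachable t u →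
      (s(u, w) ∈ (↑S : Set (Sym2 V)) ↔ s(u, w) ∈ (↑S' : Set (Sym2 V))) := by
    intro u w hu
    have hmem : s(u, w) ∈ Finset.univ.filter
        (fun e => ∃ v ∈ {v | (openGraph (↑S : Set (Sym2 V))).Reachable t v}, v ∈ e) :=
      Finset.mem_filter.2 ⟨Finset.mem_univ _, u, hu, Sym2.mem_mk_left u w⟩
    have := hagree _ hmem
    simp only [Finset.mem_coe]
    exact this
  have hK : ∀ v, (openGraph (↑S' : Set (Sym2 V))).Reachable t v ↔ (openGraph (↑S : Set (Sym2 V))).Reachable t v := by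
    intro v
    constructor
    · intro h
      exact (reachable_transfer (G' := openGraph (↑S : Set (Sym2 V)))
        (P := fun u => (openGraph (↑S : Set (Sym2 V))).Reachable t u) h (SimpleGraph.Reachable.refl t) (by
          intro u w hu huw
          rw [openGraph_adj] at huw
          have hS : s(u, w) ∈ (↑S : Set (Sym2 V)) := (key u w hu).2 huw.1
          have hadj : (openGraph (↑S : Set (Sym2 V))).Adj u w := (openGraph_adj _ u w).2 ⟨hS, huw.2⟩
          exact ⟨hu.trans hadj.reachable, hadj⟩)).1
    · intro h
      exact (reachable_transfer (G' := openGraph (↑S' : Set (Sym2 V)))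
        (P := fun u => (openGraph (↑S : Set (Sym2 V))).Reachable t u) h (SimpleGraph.Reachable.refl t) (by
          intro u w hu huw
          rw [openGraph_adj] at huw
          have hS' : s(u, w) ∈ (↑S' : Set (Sym2 V)) := (key u w hu).1 huw.1
          exact ⟨hu.trans ((openGraph_adj _ u w).2 huw).reachable, (openGraph_adj _ u w).2 ⟨hS', huw.2⟩⟩)).1
  ext e
  simp only [Finset.mem_filter, Finset.mem_univ, true_and, Set.mem_setOf_eq, hK]

/-- **The seal swap bounds one sealed part by one target cell.**  For a target vertex `t` and the other vertex `u`: the pair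
probability of {`C₂` separates `a` from `t`, and `a ↔ u` by `C₁`-open edges avoiding the `C₂`-cluster of `t`} is at most
`PrW{a ↔ u ∧ a ↮ t}` — swap along the (self-determined) set of edges touching `C_t(C₂)`; the first output is the sealed
configuration, in which `a ↔ u` (`seal_reachable_iff_of_not_mem`) and `a ↮ t` (`seal_reachable_iff`). [this work] -/
theorem Pr2W_seal_le (p : Sym2 V → ℝ) (hp0 : ∀ e, 0 ≤ p e) (hp1 : ∀ e, p e ≤ 1) (a t u : V) :
    Pr2W Finset.univ p {x : Finset (Sym2 V) × Finset (Sym2 V) | ¬ (openGraph (↑x.1 : Set (Sym2 V))).Reachable a t ∧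
        (openGraph ((↑x.2 : Set (Sym2 V)) \
          {e | ∃ v ∈ {v | (openGraph (↑x.1 : Set (Sym2 V))).Reachable t v}, v ∈ e})).Reachable a u} ≤
      PrW Finset.univ p {S : Finset (Sym2 V) | (openGraph (↑S : Set (Sym2 V))).Reachable a u ∧ ¬ (openGraph (↑S : Set (Sym2 V))).Reachable a t} := by
  set D : Finset (Sym2 V) := Finset.univ with hD
  let Fm : Finset (Sym2 V) → Finset (Sym2 V) := fun S =>
    Finset.univ.filter fun e => ∃ v ∈ {v | (openGraph (↑S : Set (Sym2 V))).Reachable t v}, v ∈ e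
  have hF : SelfDetermined Fm := selfDetermined_touchCluster t
  have hrhs : PrW D p {S : Finset (Sym2 V) | (openGraph (↑S : Set (Sym2 V))).Reachable a u ∧ ¬ (openGraph (↑S : Set (Sym2 V))).Reachable a t} =
      Pr2W D p ({S : Finset (Sym2 V) | (openGraph (↑S : Set (Sym2 V))).Reachable a u ∧ ¬ (openGraph (↑S : Set (Sym2 V))).Reachable a t} ×ˢ
        (Set.univ : Set (Finset (Sym2 V)))) := by
    rw [Pr2W_prod, PrW_univ, mul_one]
  have hsw := Pr2W_preimage_swapPair D p hF
    ({S : Finset (Sym2 V) | (openGraph (↑S : Set (Sym2 V))).Reachable a u ∧ ¬ (openGraph (↑S : Set (Sym2 V))).Reachable a t} ×ˢ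
      (Set.univ : Set (Finset (Sym2 V))))
  rw [hrhs, ← hsw]
  refine Pr2W_mono D hp0 hp1 fun x _ _ hx => ?_
  obtain ⟨hat, hreach⟩ := hx
  simp only [Set.mem_preimage, Set.mem_prod, Set.mem_univ, and_true, Set.mem_setOf_eq]
  -- the first output is the sealed configuration `Y_t = (C₂ on the edges touching K_t) ∪ (C₁ off them)`
  set K : Set V := {v | (openGraph (↑x.1 : Set (Sym2 V))).Reachable t v} with hK
  set TK : Set (Sym2 V) := {e | ∃ v ∈ K, v ∈ e} with hTK
  have hcoeF : (↑(Fm x.1) : Set (Sym2 V)) = TK := by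
    ext e; simp [Fm, hTK, hK]
  have hY : (↑(splice (Fm x.1) x.1 x.2) : Set (Sym2 V)) = ((↑x.1 : Set (Sym2 V)) ∩ TK) ∪ ((↑x.2 : Set (Sym2 V)) \ TK) := by
    rw [coe_splice, hcoeF]
  have haK : a ∉ K := fun haK => hat haK.symm
  change (openGraph (↑(splice (Fm x.1) x.1 x.2) : Set (Sym2 V))).Reachable a u ∧
    ¬ (openGraph (↑(splice (Fm x.1) x.1 x.2) : Set (Sym2 V))).Reachable a t
  rw [hY]
  constructor
  · rw [seal_reachable_iff_of_not_mem (↑x.2) (↑x.1) t K TK _ hK hTK rfl haK]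
    exact hreach
  · intro h
    have hta : (openGraph (↑x.1 : Set (Sym2 V))).Reachable t a :=
      (seal_reachable_iff (↑x.2 : Set (Sym2 V)) (↑x.1 : Set (Sym2 V)) t K TK
        (((↑x.1 : Set (Sym2 V)) ∩ TK) ∪ ((↑x.2 : Set (Sym2 V)) \ TK)) hK hTK rfl a).1 h.symm
    exact hat hta.symm

/-- **The product row reduces to the doubly-sealed-failure set** (finitary weighted form, every weight vector `p ∈ [0,1]^{Sym2 V}`):
`PrW{abc}·PrW{a|b|c} ≤ PrW{ab|c} + PrW{ac|b} + Pr2W(B)`, `B` = pairs `(C₂, C₁)` (`C₂ ∈ a|b|c`, `C₁ ∈ abc`) for which `b` is not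
joined to `a` by `C₁`-edges avoiding the `C₂`-cluster of `c` AND `c` is not joined to `a` by `C₁`-edges avoiding the `C₂`-cluster
of `b`.  [this work] -/
theorem productRow_le_add_Pr2W (p : Sym2 V → ℝ) (hp0 : ∀ e, 0 ≤ p e) (hp1 : ∀ e, p e ≤ 1) (a b c : V) :
    PrW Finset.univ p {S : Finset (Sym2 V) | (openGraph (↑S : Set (Sym2 V))).Reachable a b ∧ (openGraph (↑S : Set (Sym2 V))).Reachable a c} *
      PrW Finset.univ p {S : Finset (Sym2 V) | ¬ (openGraph (↑S : Set (Sym2 V))).Reachable a b ∧ ¬ (openGraph (↑S : Set (Sym2 V))).Reachable a c ∧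
        ¬ (openGraph (↑S : Set (Sym2 V))).Reachable b c} ≤
    PrW Finset.univ p {S : Finset (Sym2 V) | (openGraph (↑S : Set (Sym2 V))).Reachable a b ∧ ¬ (openGraph (↑S : Set (Sym2 V))).Reachable a c} +
    PrW Finset.univ p {S : Finset (Sym2 V) | (openGraph (↑S : Set (Sym2 V))).Reachable a c ∧ ¬ (openGraph (↑S : Set (Sym2 V))).Reachable a b} +
    Pr2W Finset.univ p {x : Finset (Sym2 V) × Finset (Sym2 V) | (¬ (openGraph (↑x.1 : Set (Sym2 V))).Reachable a b ∧ ¬ (openGraph (↑x.1 : Set (Sym2 V))).Reachable a c ∧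
          ¬ (openGraph (↑x.1 : Set (Sym2 V))).Reachable b c) ∧
        ((openGraph (↑x.2 : Set (Sym2 V))).Reachable a b ∧ (openGraph (↑x.2 : Set (Sym2 V))).Reachable a c) ∧
        ¬ (openGraph ((↑x.2 : Set (Sym2 V)) \
            {e | ∃ v ∈ {v | (openGraph (↑x.1 : Set (Sym2 V))).Reachable c v}, v ∈ e})).Reachable a b ∧
        ¬ (openGraph ((↑x.2 : Set (Sym2 V)) \
            {e | ∃ v ∈ {v | (openGraph (↑x.1 : Set (Sym2 V))).Reachable b v}, v ∈ e})).Reachable a c} := by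
  set D : Finset (Sym2 V) := Finset.univ with hD
  -- abbreviations (all `let`s are definitional)
  let R : Finset (Sym2 V) → V → V → Prop := fun S x y => (openGraph (↑S : Set (Sym2 V))).Reachable x y
  let Rav : Finset (Sym2 V) → Finset (Sym2 V) → V → V → Prop := fun S₂ S₁ t u =>
    (openGraph ((↑S₁ : Set (Sym2 V)) \ {e | ∃ v ∈ {v | R S₂ t v}, v ∈ e})).Reachable a u
  let abc : Set (Finset (Sym2 V)) := {S | R S a b ∧ R S a c}
  let sep : Set (Finset (Sym2 V)) := {S | ¬ R S a b ∧ ¬ R S a c ∧ ¬ R S b c}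
  let abEv : Set (Finset (Sym2 V)) := {S | R S a b ∧ ¬ R S a c}
  let acEv : Set (Finset (Sym2 V)) := {S | R S a c ∧ ¬ R S a b}
  let Mc : Set (Finset (Sym2 V) × Finset (Sym2 V)) := {x | ¬ R x.1 a c ∧ Rav x.1 x.2 c b}
  let Mb : Set (Finset (Sym2 V) × Finset (Sym2 V)) := {x | ¬ R x.1 a b ∧ Rav x.1 x.2 b c}
  let B : Set (Finset (Sym2 V) × Finset (Sym2 V)) :=
    {x | x.1 ∈ sep ∧ x.2 ∈ abc ∧ ¬ Rav x.1 x.2 c b ∧ ¬ Rav x.1 x.2 b c}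
  change PrW D p abc * PrW D p sep ≤ PrW D p abEv + PrW D p acEv + Pr2W D p B
  have hprod : PrW D p abc * PrW D p sep = Pr2W D p (sep ×ˢ abc) := by
    rw [Pr2W_prod, mul_comm]
  have hsplit : Pr2W D p (sep ×ˢ abc) ≤ Pr2W D p Mc + Pr2W D p Mb + Pr2W D p B := by
    calc Pr2W D p (sep ×ˢ abc) ≤ Pr2W D p ((Mc ∪ Mb) ∪ B) :=
          Pr2W_mono D hp0 hp1 fun x _ _ hx => by
            obtain ⟨h1, h2⟩ := Set.mem_prod.1 hx
            by_cases hc : Rav x.1 x.2 c b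
            · exact Or.inl (Or.inl ⟨h1.2.1, hc⟩)
            · by_cases hb : Rav x.1 x.2 b c
              · exact Or.inl (Or.inr ⟨h1.1, hb⟩)
              · exact Or.inr ⟨h1, h2, hc, hb⟩
      _ ≤ Pr2W D p (Mc ∪ Mb) + Pr2W D p B := Pr2W_union_le D hp0 hp1 _ _
      _ ≤ Pr2W D p Mc + Pr2W D p Mb + Pr2W D p B := by
          have := Pr2W_union_le D hp0 hp1 Mc Mb; linarith
  have hMc : Pr2W D p Mc ≤ PrW D p abEv := Pr2W_seal_le p hp0 hp1 a c b
  have hMb : Pr2W D p Mb ≤ PrW D p acEv := Pr2W_seal_le p hp0 hp1 a b c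
  linarith

/-- **The same reduction for the measure `prodBernoulli w`** (every finite weighted graph; the four one-configuration terms as
`(prodBernoulli w).real` of the tree's events `openConn`, by the bridge `DecisionTree.prodBernoulli_real_eq_PrW`; the pair term
stays in the finitary form `Pr2W univ (w·)`):
`P(a↔b ∧ a↔c)·P(a↮b ∧ a↮c ∧ b↮c) ≤ P(a↔b ∧ a↮c) + P(a↔c ∧ a↮b) + Pr2W(B)`. [this work] -/
theorem productRow_le_add_Pr2W_prodBernoulli (w : Sym2 V → unitInterval) (a b c : V) :
    (Literature.Probability.LatticeModels.prodBernoulli w).real (openConn a b ∩ openConn a c) *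
      (Literature.Probability.LatticeModels.prodBernoulli w).real ((openConn a b)ᶜ ∩ (openConn a c)ᶜ ∩ (openConn b c)ᶜ) ≤
    (Literature.Probability.LatticeModels.prodBernoulli w).real (openConn a b ∩ (openConn a c)ᶜ) +
    (Literature.Probability.LatticeModels.prodBernoulli w).real (openConn a c ∩ (openConn a b)ᶜ) +
    Pr2W Finset.univ (fun e => (w e : ℝ))
      {x : Finset (Sym2 V) × Finset (Sym2 V) | (¬ (openGraph (↑x.1 : Set (Sym2 V))).Reachable a b ∧
          ¬ (openGraph (↑x.1 : Set (Sym2 V))).Reachable a c ∧ ¬ (openGraph (↑x.1 : Set (Sym2 V))).Reachable b c) ∧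
        ((openGraph (↑x.2 : Set (Sym2 V))).Reachable a b ∧ (openGraph (↑x.2 : Set (Sym2 V))).Reachable a c) ∧
        ¬ (openGraph ((↑x.2 : Set (Sym2 V)) \
            {e | ∃ v ∈ {v | (openGraph (↑x.1 : Set (Sym2 V))).Reachable c v}, v ∈ e})).Reachable a b ∧
        ¬ (openGraph ((↑x.2 : Set (Sym2 V)) \
            {e | ∃ v ∈ {v | (openGraph (↑x.1 : Set (Sym2 V))).Reachable b v}, v ∈ e})).Reachable a c} := by
  set p : Sym2 V → ℝ := fun e => (w e : ℝ) with hp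
  have hp0 : ∀ e, 0 ≤ p e := fun e => (w e).2.1
  have hp1 : ∀ e, p e ≤ 1 := fun e => (w e).2.2
  have hdet : ∀ C : Set (BondConfig V), DeterminedBy C (↑(Finset.univ : Finset (Sym2 V)) : Set (Sym2 V)) := by
    intro C
    rw [determinedBy_iff]
    intro ω ω' h
    rw [Finset.coe_univ, Set.inter_univ, Set.inter_univ] at h
    rw [h]
  have eABC : (Literature.Probability.LatticeModels.prodBernoulli w).real (openConn a b ∩ openConn a c) =
      PrW Finset.univ p {S : Finset (Sym2 V) | (openGraph (↑S : Set (Sym2 V))).Reachable a b ∧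
        (openGraph (↑S : Set (Sym2 V))).Reachable a c} :=
    prodBernoulli_real_eq_PrW w (hdet _) fun S _ => Iff.rfl
  have eTri : (Literature.Probability.LatticeModels.prodBernoulli w).real
        ((openConn a b)ᶜ ∩ (openConn a c)ᶜ ∩ (openConn b c)ᶜ) =
      PrW Finset.univ p {S : Finset (Sym2 V) | ¬ (openGraph (↑S : Set (Sym2 V))).Reachable a b ∧
        ¬ (openGraph (↑S : Set (Sym2 V))).Reachable a c ∧ ¬ (openGraph (↑S : Set (Sym2 V))).Reachable b c} :=
    prodBernoulli_real_eq_PrW w (hdet _) fun S _ => by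
      simp only [Set.mem_setOf_eq, Set.mem_inter_iff, Set.mem_compl_iff, openConn, and_assoc]
  have eAB : (Literature.Probability.LatticeModels.prodBernoulli w).real (openConn a b ∩ (openConn a c)ᶜ) =
      PrW Finset.univ p {S : Finset (Sym2 V) | (openGraph (↑S : Set (Sym2 V))).Reachable a b ∧
        ¬ (openGraph (↑S : Set (Sym2 V))).Reachable a c} :=
    prodBernoulli_real_eq_PrW w (hdet _) fun S _ => Iff.rfl
  have eAC : (Literature.Probability.LatticeModels.prodBernoulli w).real (openConn a c ∩ (openConn a b)ᶜ) =
      PrW Finset.univ p {S : Finset (Sym2 V) | (openGraph (↑S : Set (Sym2 V))).Reachable a c ∧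
        ¬ (openGraph (↑S : Set (Sym2 V))).Reachable a b} :=
    prodBernoulli_real_eq_PrW w (hdet _) fun S _ => Iff.rfl
  rw [eABC, eTri, eAB, eAC]
  exact productRow_le_add_Pr2W p hp0 hp1 a b c

/-- **The remaining obligation, packaged.**  If the doubly-sealed-failure set is bounded by `m` times the two target cells,
`Pr2W(B) ≤ m·(P(ab|c) + P(ac|b))` (the open decoding problem of the memo; `m = 2` is the target), then the product row F1 holds with
constant `1 + m`: `P(a↔b ∧ a↔c)·P(a|b|c) ≤ (1+m)·(P(ab|c) + P(ac|b))` on every finite weighted graph.  (With `1 + m ≤ 3` this is the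
per-apex hypothesis shape of ✓ p560550 `ThreePort.le_one_reached_le_of_productRow3`, up to the off-observer restriction handled there.)
[this work] -/
theorem productRow_of_Pr2W_bound (w : Sym2 V → unitInterval) (a b c : V) (m : ℝ)
    (hB : Pr2W Finset.univ (fun e => (w e : ℝ))
      {x : Finset (Sym2 V) × Finset (Sym2 V) | (¬ (openGraph (↑x.1 : Set (Sym2 V))).Reachable a b ∧
          ¬ (openGraph (↑x.1 : Set (Sym2 V))).Reachable a c ∧ ¬ (openGraph (↑x.1 : Set (Sym2 V))).Reachable b c) ∧
        ((openGraph (↑x.2 : Set (Sym2 V))).Reachable a b ∧ (openGraph (↑x.2 : Set (Sym2 V))).Reachable a c) ∧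
        ¬ (openGraph ((↑x.2 : Set (Sym2 V)) \
            {e | ∃ v ∈ {v | (openGraph (↑x.1 : Set (Sym2 V))).Reachable c v}, v ∈ e})).Reachable a b ∧
        ¬ (openGraph ((↑x.2 : Set (Sym2 V)) \
            {e | ∃ v ∈ {v | (openGraph (↑x.1 : Set (Sym2 V))).Reachable b v}, v ∈ e})).Reachable a c} ≤
      m * ((Literature.Probability.LatticeModels.prodBernoulli w).real (openConn a b ∩ (openConn a c)ᶜ) +
        (Literature.Probability.LatticeModels.prodBernoulli w).real (openConn a c ∩ (openConn a b)ᶜ))) :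
    (Literature.Probability.LatticeModels.prodBernoulli w).real (openConn a b ∩ openConn a c) *
      (Literature.Probability.LatticeModels.prodBernoulli w).real ((openConn a b)ᶜ ∩ (openConn a c)ᶜ ∩ (openConn b c)ᶜ) ≤
    (1 + m) * ((Literature.Probability.LatticeModels.prodBernoulli w).real (openConn a b ∩ (openConn a c)ᶜ) +
      (Literature.Probability.LatticeModels.prodBernoulli w).real (openConn a c ∩ (openConn a b)ᶜ)) := by
  have h := productRow_le_add_Pr2W_prodBernoulli w a b c
  linarith

end ThreeClusterSwap

end Summit.CriticalPhenomena.PercolationContinuityZ3.Theorems
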